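/-
Copyright (c) 2026 the pub-hodgecm-mathlib formalisation cell (harness21).  Prover seat hodgecm-mathlib-K2Liu-p06 (g4), Track B «K2-LIT»,
#184♮ = hLiu418 = `stmt-HodgeConjecture-24832`; #42S payer road, organ S1 (local Siegel–Weil spanning), ROAD W file F3 (census
`K2/K2Liu-p06/g4/CENSUS-S1-LocalSWSpanning.K2Liu-p06-g4.md` §0 (W2)+(SC), §8; RULING «M-157t» (2),(4)).
-/
import Summits.HodgeConjecture.HodgeConjecture.Theorems.K2LiuLocalSWBigCellGeneration   -- ★ F2 (W1) `mem_of_bigCell_pieces_mem`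
import HarnessLib

/-!
# Crux `HLiu418`, #42S organ S1, ROAD W, file F3a: THE LATTICE LEMMA (W2)
# (one big-cell section whose profile is the indicator of a compact open subgroup generates every big-cell section; averaging produces it)

Cell `hodgecm-mathlib`, crux item hLiu418 = `stmt-HodgeConjecture-24832`; squad K2 ∕ K2Liu; prover K2Liu-p06 (g4), the dedicated S1 hand.
THEOREMS ONLY (no `def`, no instance, no notation, no named-fact hypothesis, no `sorry`); lane `--supports stmt-HodgeConjecture-24832 --as helper`.

WHY.  ROAD W reduces the local spanning `I_v(½, χ_v) = R₂(V⁺_v) + R₂(V⁻_v)` to ONE explicit element (census §0): by ★ F2 (W1) an `H_v`-stable `U ≤ I_v(s,χ_v)`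
containing every section supported in `P_Δ·C`, `C` a compact subset of the big cell `Ω = P_Δ w_Δ N_Δ`, is everything; this file proves **(W2)**: such `U` contains
all those sections as soon as it contains ONE section `e` vanishing off `Ω` whose PROFILE `n ↦ e(w_Δ n)` on `N_Δ(F_v)` is the indicator of a compact subgroup
`N₁ ≤ N_Δ` — and that such an `e` is obtained from ANY `f₀ ∈ U` vanishing off `Ω` with locally constant, compactly supported profile of NON-ZERO SUM
(`Σ_{N₁∕N₀} f₀(w_Δ q) ≠ 0`) by averaging over `N₁∕N₀`.  Pure group algebra + «compact ∕ open ⇒ finitely many cosets»; NO Fourier transform, NO Haar measure: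
* averaging (`profile_sum_translates_of_mem`, `profile_sum_translates_of_not_mem`): `F₁ := Σ_{q ∈ N₁∕N₀} R(q) f₀` has profile `S·1_{N₁}`;
* dilation (`profile_dilate`): for `m` with `w m = p_m w` (`p_m ∈ P_Δ`) normalising `N_Δ`, `R(m) F` has profile `χ(p_m)·S·1_{m N₁ m⁻¹}`;
* translation and tiling (`mem_of_indicator_profile_mem`): a section vanishing off `Ω` whose profile is right-invariant under an open `N′ ≥ m N₁ m⁻¹` and
  supported in a compact set is a finite combination of `N_Δ`-translates of `R(m) F₁`, hence lies in `U`;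
* the sequel F3b `K2LiuLocalSWSpanningCriterion` assembles (W1) ★ `mem_of_bigCell_pieces_mem` + (W2) into the SPANNING CRITERION (SC) and supplies the bridges to
  ★ D1 `localDegPS`; everything here is GENERIC in the group (`P, N ≤ G`, `N` commutative, `w ∈ G`; no topology except «compact ∕ open ⇒ finitely many cosets»),
  hence serves every `U(n,n)`, every `s`, every `χ_v`.
References: [BernsteinZelevinsky1976] §1.1–1.5, §2.2 (l-spaces; compactly supported sections on an open orbit ≅ `S(N)`); [Casselman1995] §3.1, §6.1;
[HarrisKudlaSweet1996] §1 (1.15); [KudlaSweet1997] Thm 1.2 (the spanning ROAD W pays — NOT used).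
HONEST LABEL.  Count-neutral helper: `HC_CM` is proved only modulo the 7 printed citations (2 remaining named inputs: hLiu418 = `stmt-HodgeConjecture-24832`,
h413 = `stmt-HodgeConjecture-24833`) until rung 0 closes.
-/

set_option autoImplicit false
set_option linter.dupNamespace false -- the mandated namespace repeats `HodgeConjecture.HodgeConjecture`

noncomputable section

open NumberField IsDedekindDomain
open scoped Matrix Pointwise

namespace Summit.HodgeConjecture.HodgeConjecture.Cruxes.HLiu418.K2LiuLocalSWBigCellLattice

open Literature.NumberTheory.Automorphic
open Literature.NumberTheory.GelbartRogawski1991 Literature.NumberTheory.GelbartRogawski1991.GRConstruction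
open Literature.NumberTheory.GelbartRogawski1991.UnitaryDualPair
open Literature.NumberTheory.K2Lit.SiegelDoubled Literature.NumberTheory.K2Lit.LocalSiegelDoubled
open Summit.HodgeConjecture.HodgeConjecture.Cruxes.HLiu418.K2LiuLocalSWBigCellGeneration

/-! ## §1 Abstract: averaging, dilation, tiling -/

section Abstract

variable {G : Type*} [Group G]

/-! ### §1.1 Averaging over `N₁ ∕ N₀` -/

/-- reindexing the average: `q ↦ [n · q̃]` is a bijection of `N₁ ∕ N₀` for `n ∈ N₁`. [cite: BernsteinZelevinsky1976, §1.1] -/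
theorem bijective_mk_mul_out {N₁ : Subgroup G} (N₀' : Subgroup N₁) (n : N₁) :
    Function.Bijective fun q : N₁ ⧸ N₀' => (QuotientGroup.mk (n * q.out) : N₁ ⧸ N₀') := by
  have hinj : ∀ m : N₁, Function.Injective fun q : N₁ ⧸ N₀' => (QuotientGroup.mk (m * q.out) : N₁ ⧸ N₀') := by
    intro m q q' h
    have h' : (QuotientGroup.mk q.out : N₁ ⧸ N₀') = QuotientGroup.mk q'.out := by
      rw [QuotientGroup.eq] at h ⊢
      simpa [mul_assoc] using h
    rwa [QuotientGroup.out_eq', QuotientGroup.out_eq'] at h'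
  refine ⟨hinj n, fun q => ?_⟩
  refine ⟨QuotientGroup.mk (n⁻¹ * q.out), ?_⟩
  obtain ⟨h, hh⟩ := QuotientGroup.mk_out_eq_mul N₀' (n⁻¹ * q.out)
  simp only [hh, ← mul_assoc, mul_inv_cancel, one_mul]
  rw [QuotientGroup.mk_mul_of_mem _ h.2, QuotientGroup.out_eq']

/-- **AVERAGING, inside `N₁`**: if `f₀` is right-invariant under `N₀ ≤ N₁`, then for `n ∈ N₁` the sum of the translates over `N₁ ∕ N₀` is the full sum:
`Σ_q f₀(x n q̃) = Σ_q f₀(x q̃)`. [cite: BernsteinZelevinsky1976, §1.1] -/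
theorem sum_translates_mul_of_mem {N₀ N₁ : Subgroup G} [Fintype (N₁ ⧸ N₀.subgroupOf N₁)]
    (f₀ : G → ℂ) (hf₀ : ∀ h, ∀ u ∈ N₀, f₀ (h * u) = f₀ h) (x : G) (n : G) (hn : n ∈ N₁) :
    ∑ q : N₁ ⧸ N₀.subgroupOf N₁, f₀ (x * n * (q.out : G)) = ∑ q : N₁ ⧸ N₀.subgroupOf N₁, f₀ (x * (q.out : G)) := by
  set σ : N₁ ⧸ N₀.subgroupOf N₁ → N₁ ⧸ N₀.subgroupOf N₁ := fun q => QuotientGroup.mk (⟨n, hn⟩ * q.out) with hσ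
  have hbij : Function.Bijective σ := bijective_mk_mul_out (N₀.subgroupOf N₁) ⟨n, hn⟩
  set g : N₁ ⧸ N₀.subgroupOf N₁ → ℂ := fun q => f₀ (x * (q.out : G)) with hg
  -- `g (σ q) = f₀ (x * n * q.out)`
  have hterm : ∀ q : N₁ ⧸ N₀.subgroupOf N₁, g (σ q) = f₀ (x * n * (q.out : G)) := by
    intro q
    obtain ⟨h, hh⟩ := QuotientGroup.mk_out_eq_mul (N₀.subgroupOf N₁) (⟨n, hn⟩ * q.out)
    have hhG : ((σ q).out : G) = n * (q.out : G) * (h : N₁) := by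
      rw [hσ]
      exact congrArg Subtype.val hh
    rw [hg]
    show f₀ (x * ((σ q).out : G)) = _
    rw [hhG, ← mul_assoc, ← mul_assoc]
    exact hf₀ _ _ (Subgroup.mem_subgroupOf.1 h.2)
  calc ∑ q : N₁ ⧸ N₀.subgroupOf N₁, f₀ (x * n * (q.out : G))
        = ∑ q : N₁ ⧸ N₀.subgroupOf N₁, g (σ q) := Finset.sum_congr rfl fun q _ => (hterm q).symm
    _ = ∑ q : N₁ ⧸ N₀.subgroupOf N₁, g q := hbij.sum_comp g
    _ = ∑ q : N₁ ⧸ N₀.subgroupOf N₁, f₀ (x * (q.out : G)) := rfl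

/-- **the averaged function**: profile value `S` on `N₁`. With `F₁ h := Σ_q f₀ (h q̃)`: `F₁ (w n) = S := Σ_q f₀ (w q̃)` for `n ∈ N₁`.
[cite: BernsteinZelevinsky1976, §1.1] -/
theorem profile_sum_translates_of_mem {N₀ N₁ : Subgroup G} [Fintype (N₁ ⧸ N₀.subgroupOf N₁)]
    (f₀ : G → ℂ) (hf₀ : ∀ h, ∀ u ∈ N₀, f₀ (h * u) = f₀ h) (w n : G) (hn : n ∈ N₁) :
    ∑ q : N₁ ⧸ N₀.subgroupOf N₁, f₀ (w * n * (q.out : G)) = ∑ q : N₁ ⧸ N₀.subgroupOf N₁, f₀ (w * (q.out : G)) :=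
  sum_translates_mul_of_mem f₀ hf₀ w n hn

/-- **the averaged function vanishes at `w n` for `n ∈ N ∖ N₁`** when `f₀ (w n') = 0` for all `n' ∈ N ∖ N₁` (`N₁ ≤ N`).
[cite: BernsteinZelevinsky1976, §1.1] -/
theorem profile_sum_translates_of_not_mem {N₀ N₁ N : Subgroup G} (h1N : N₁ ≤ N) [Fintype (N₁ ⧸ N₀.subgroupOf N₁)]
    (f₀ : G → ℂ) (w : G) (hsupp : ∀ n ∈ N, n ∉ N₁ → f₀ (w * n) = 0) (n : G) (hn : n ∈ N) (hn1 : n ∉ N₁) :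
    ∑ q : N₁ ⧸ N₀.subgroupOf N₁, f₀ (w * n * (q.out : G)) = 0 := by
  refine Finset.sum_eq_zero fun q _ => ?_
  rw [mul_assoc]
  refine hsupp _ (N.mul_mem hn (h1N (q.out).2)) fun hmem => hn1 ?_
  have : n = n * (q.out : G) * ((q.out : G))⁻¹ := by rw [mul_assoc, mul_inv_cancel, mul_one]
  rw [this]
  exact N₁.mul_mem hmem (N₁.inv_mem (q.out).2)

/-! ### §1.2 Sections vanishing off the big cell `Ω = P w N`: law, translation, dilation -/

/-- vanishing off `Ω = P w N` is stable under right translation by `N`. [cite: BernsteinZelevinsky1976, §2.2] -/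
theorem offCell_translate {P N : Subgroup G} {w : G} {f₀ : G → ℂ}
    (hoff : ∀ h, (¬ ∃ p ∈ P, ∃ n ∈ N, h = p * w * n) → f₀ h = 0) (n₀ : G) (hn₀ : n₀ ∈ N) (h : G)
    (hh : ¬ ∃ p ∈ P, ∃ n ∈ N, h = p * w * n) : f₀ (h * n₀) = 0 := by
  refine hoff _ fun ⟨p, hp, n, hn, hpn⟩ => hh ⟨p, hp, n * n₀⁻¹, N.mul_mem hn (N.inv_mem hn₀), ?_⟩
  rw [← mul_assoc, ← hpn, mul_assoc, mul_inv_cancel, mul_one]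

/-- vanishing off `Ω` is stable under right translation by an `m` normalising `N` with `w m ∈ P w`. [cite: BernsteinZelevinsky1976, §2.2] -/
theorem offCell_dilate {P N : Subgroup G} {w : G} {f₀ : G → ℂ}
    (hoff : ∀ h, (¬ ∃ p ∈ P, ∃ n ∈ N, h = p * w * n) → f₀ h = 0) {m pm : G} (hpm : pm ∈ P) (hwm : w * m = pm * w)
    (hconj : ∀ n ∈ N, m * n * m⁻¹ ∈ N) (h : G) (hh : ¬ ∃ p ∈ P, ∃ n ∈ N, h = p * w * n) : f₀ (h * m) = 0 := by
  refine hoff _ fun ⟨p, hp, n, hn, hpn⟩ => hh ⟨p * pm⁻¹, P.mul_mem hp (P.inv_mem hpm), m * n * m⁻¹, hconj n hn, ?_⟩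
  have hw : pm⁻¹ * w * m = w := by rw [mul_assoc, hwm, ← mul_assoc, inv_mul_cancel, one_mul]
  have key : p * pm⁻¹ * w * (m * n * m⁻¹) = p * (pm⁻¹ * w * m) * n * m⁻¹ := by group
  rw [key, hw, ← hpn, mul_assoc, mul_inv_cancel, mul_one]

/-- **DILATION of a profile, inside**: if `F (w n) = S` for `n ∈ N₁`, `F` has the left law `χ`, and `w m = p_m w`, then `F (w n m) = χ(p_m) S` whenever
`m⁻¹ n m ∈ N₁`. [cite: BernsteinZelevinsky1976, §2.2] -/
theorem profile_dilate_of_mem {P N₁ : Subgroup G} {χ : G → ℂ} {w : G} {F : G → ℂ} {S : ℂ}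
    (hF : ∀ p ∈ P, ∀ h, F (p * h) = χ p * F h) (hon : ∀ n ∈ N₁, F (w * n) = S)
    {m pm : G} (hpm : pm ∈ P) (hwm : w * m = pm * w) (n : G) (hn : m⁻¹ * n * m ∈ N₁) :
    F (w * n * m) = χ pm * S := by
  have : w * n * m = pm * (w * (m⁻¹ * n * m)) := by
    rw [← mul_assoc pm, ← hwm]
    group
  rw [this, hF pm hpm, hon _ hn]

/-- **DILATION of a profile, outside**: if `F (w n) = 0` for `n ∈ N ∖ N₁`, `F` has the left law `χ`, `w m = p_m w` and `m` normalises `N`, then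
`F (w n m) = 0` for `n ∈ N` with `m⁻¹ n m ∉ N₁`. [cite: BernsteinZelevinsky1976, §2.2] -/
theorem profile_dilate_of_not_mem {P N N₁ : Subgroup G} {χ : G → ℂ} {w : G} {F : G → ℂ}
    (hF : ∀ p ∈ P, ∀ h, F (p * h) = χ p * F h) (hoff : ∀ n ∈ N, n ∉ N₁ → F (w * n) = 0)
    {m pm : G} (hpm : pm ∈ P) (hwm : w * m = pm * w) (hconj' : ∀ n ∈ N, m⁻¹ * n * m ∈ N) (n : G) (hn : n ∈ N)
    (hn1 : m⁻¹ * n * m ∉ N₁) : F (w * n * m) = 0 := by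
  have : w * n * m = pm * (w * (m⁻¹ * n * m)) := by
    rw [← mul_assoc pm, ← hwm]
    group
  rw [this, hF pm hpm, hoff _ (hconj' n hn) hn1, mul_zero]

/-! ### §1.3 (W2): one indicator profile generates all compact profiles -/

variable [TopologicalSpace G] [IsTopologicalGroup G]

/-- finitely many right cosets of an open-in-`N` subgroup `N₂ ≤ N` meet a compact `S₀ ⊆ N`. [cite: BernsteinZelevinsky1976, §1.1] -/
theorem exists_finset_cosets_cover {N N₂ : Subgroup G} (h2N : N₂ ≤ N) {O : Set G} (hO : IsOpen O) (hON : ∀ x ∈ O, x ∈ N → x ∈ N₂)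
    (h1O : (1 : G) ∈ O) {S₀ : Set G} (hS₀ : IsCompact S₀) (hS₀N : S₀ ⊆ N) :
    ∃ T : Finset G, (↑T ⊆ S₀) ∧ ∀ n ∈ S₀, ∃ t ∈ T, n * t⁻¹ ∈ N₂ := by
  have _ := h2N
  -- cover `S₀` by the open sets `O t`, `t ∈ S₀`
  have hcov : S₀ ⊆ ⋃ t ∈ S₀, (fun x => x * t) '' O := fun t ht => Set.mem_biUnion ht ⟨1, h1O, one_mul t⟩
  obtain ⟨T, hTS, hTfin, hTcov⟩ := hS₀.elim_finite_subcover_image (fun t _ => (Homeomorph.mulRight t).isOpenMap _ hO) hcov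
  refine ⟨hTfin.toFinset, fun t ht => hTS (hTfin.mem_toFinset.1 ht), fun n hn => ?_⟩
  have := hTcov hn
  simp only [Set.mem_iUnion, Set.mem_image] at this
  obtain ⟨t, ht, x, hx, hxn⟩ := this
  refine ⟨t, hTfin.mem_toFinset.2 ht, ?_⟩
  have hxt : x * t = n := hxn
  have hx' : n * t⁻¹ = x := by rw [← hxt, mul_assoc, mul_inv_cancel, mul_one]
  rw [hx']
  refine hON x hx ?_
  rw [← hx']
  exact N.mul_mem (hS₀N hn) (N.inv_mem (hS₀N (hTS ht)))

/-- **(W2) THE LATTICE LEMMA.**  `P, N ≤ G`, `N` commutative, `w ∈ G`, `χ` non-vanishing on `P`; `U ≤ (G → ℂ)` stable under right translations, containing a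
function `e` with the left law `χ`, vanishing off `Ω = P w N`, whose profile is `S·1_{N₁}` on `N` (`S ≠ 0`, `N₁ ≤ N`).  Let `m` normalise `N` with
`w m = p_m w` (`p_m ∈ P`), and put `N₂ := {u ∈ N : m⁻¹ u m ∈ N₁}` (open in `N`: it contains `O ∩ N` for an open `O ∋ 1`).  Then every `f` with the law `χ`,
vanishing off `Ω`, whose profile is right-`N₂`-invariant and supported in a compact subset of `N`, lies in `U`: it is the finite combination
`Σ_t f(w t)·(χ(p_m) S)⁻¹ · R(t⁻¹) R(m) e` over representatives `t` of the `N₂`-cosets meeting the support.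
[cite: BernsteinZelevinsky1976, §1.5, §2.2] [cite: Casselman1995, §6.1] -/
theorem mem_of_indicator_profile_mem {P N N₁ : Subgroup G} (hN : ∀ x ∈ N, ∀ y ∈ N, x * y = y * x) (h1N : N₁ ≤ N)
    {χ : G → ℂ} (hχ : ∀ p ∈ P, χ p ≠ 0) {w : G}
    (U : Submodule ℂ (G → ℂ)) (hU : ∀ F ∈ U, ∀ g : G, (fun h => F (h * g)) ∈ U)
    {e : G → ℂ} (heU : e ∈ U) (he : ∀ p ∈ P, ∀ h, e (p * h) = χ p * e h)
    (heoff : ∀ h, (¬ ∃ p ∈ P, ∃ n ∈ N, h = p * w * n) → e h = 0) {S : ℂ} (hS : S ≠ 0)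
    (heon : ∀ n ∈ N₁, e (w * n) = S) (heout : ∀ n ∈ N, n ∉ N₁ → e (w * n) = 0)
    {m pm : G} (hpm : pm ∈ P) (hwm : w * m = pm * w) (hconj : ∀ n ∈ N, m * n * m⁻¹ ∈ N) (hconj' : ∀ n ∈ N, m⁻¹ * n * m ∈ N)
    {O : Set G} (hO : IsOpen O) (h1O : (1 : G) ∈ O) (hON₂ : ∀ x ∈ O, x ∈ N → m⁻¹ * x * m ∈ N₁)
    (f : G → ℂ) (hf : ∀ p ∈ P, ∀ h, f (p * h) = χ p * f h) (hfoff : ∀ h, (¬ ∃ p ∈ P, ∃ n ∈ N, h = p * w * n) → f h = 0)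
    (hfinv : ∀ n ∈ N, ∀ u ∈ N, m⁻¹ * u * m ∈ N₁ → f (w * n * u) = f (w * n))
    {S₀ : Set G} (hS₀ : IsCompact S₀) (hS₀N : S₀ ⊆ N) (hfsupp : ∀ n ∈ N, f (w * n) ≠ 0 → n ∈ S₀) :
    f ∈ U := by
  classical
  have _ := h1N
  -- `N₂ = {u ∈ N : m⁻¹ u m ∈ N₁}`
  set N₂ : Subgroup G :=
    { carrier := {x | x ∈ N ∧ m⁻¹ * x * m ∈ N₁}
      one_mem' := ⟨N.one_mem, by simp [N₁.one_mem]⟩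
      mul_mem' := fun {x y} hx hy => ⟨N.mul_mem hx.1 hy.1, by
        have : m⁻¹ * (x * y) * m = (m⁻¹ * x * m) * (m⁻¹ * y * m) := by group
        rw [this]; exact N₁.mul_mem hx.2 hy.2⟩
      inv_mem' := fun {x} hx => ⟨N.inv_mem hx.1, by
        have : m⁻¹ * x⁻¹ * m = (m⁻¹ * x * m)⁻¹ := by group
        rw [this]; exact N₁.inv_mem hx.2⟩ } with hN₂
  have hmemN₂ : ∀ x, x ∈ N₂ ↔ x ∈ N ∧ m⁻¹ * x * m ∈ N₁ := fun x => Iff.rfl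
  have h2N : N₂ ≤ N := fun x hx => hx.1
  obtain ⟨T, hTS₀, hT⟩ := exists_finset_cosets_cover h2N hO (fun x hx hxN => ⟨hxN, hON₂ x hx hxN⟩) h1O hS₀ hS₀N
  -- the finite set of cosets meeting `S₀`, one representative each
  set 𝒞 : Finset (Set G) := T.image fun t => {x | x * t⁻¹ ∈ N₂} with h𝒞
  have hrep : ∀ c ∈ 𝒞, ∃ t, t ∈ T ∧ c = {x | x * t⁻¹ ∈ N₂} := fun c hc => by
    obtain ⟨t, ht, rfl⟩ := Finset.mem_image.1 hc
    exact ⟨t, ht, rfl⟩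
  choose! rep hrepT hrepc using hrep
  have hrepN : ∀ c ∈ 𝒞, rep c ∈ N := fun c hc => hS₀N (hTS₀ (hrepT c hc))
  have hmem_c : ∀ c ∈ 𝒞, ∀ x, x ∈ c ↔ x * (rep c)⁻¹ ∈ N₂ := fun c hc x => Set.ext_iff.1 (hrepc c hc) x
  -- the dilated generator `e₁ = R(m) e` and the candidate `f'`
  set e₁ : G → ℂ := fun h => e (h * m) with he₁
  have he₁U : e₁ ∈ U := hU e heU m
  set a : Set G → ℂ := fun c => f (w * rep c) * (χ pm * S)⁻¹ with ha
  set f' : G → ℂ := fun h => ∑ c ∈ 𝒞, a c * e₁ (h * (rep c)⁻¹) with hf'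
  have hf'U : f' ∈ U := by
    have : f' = ∑ c ∈ 𝒞, a c • fun h => e₁ (h * (rep c)⁻¹) := by
      funext h
      simp only [hf', Finset.sum_apply, Pi.smul_apply, smul_eq_mul]
    rw [this]
    exact Submodule.sum_mem U fun c hc => Submodule.smul_mem U _ (hU e₁ he₁U _)
  -- profile of the translated dilated generator
  have hprof_mem : ∀ c ∈ 𝒞, ∀ n ∈ N, n * (rep c)⁻¹ ∈ N₂ → e₁ (w * n * (rep c)⁻¹) = χ pm * S := by
    intro c hc n hn h2
    show e (w * n * (rep c)⁻¹ * m) = _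
    rw [mul_assoc w]
    exact profile_dilate_of_mem he heon hpm hwm _ ((hmemN₂ _).1 h2).2
  have hprof_not : ∀ c ∈ 𝒞, ∀ n ∈ N, n * (rep c)⁻¹ ∉ N₂ → e₁ (w * n * (rep c)⁻¹) = 0 := by
    intro c hc n hn h2
    have hn' : n * (rep c)⁻¹ ∈ N := N.mul_mem hn (N.inv_mem (hrepN c hc))
    show e (w * n * (rep c)⁻¹ * m) = _
    rw [mul_assoc w]
    exact profile_dilate_of_not_mem (N := N) he heout hpm hwm hconj' _ hn' fun h' => h2 ((hmemN₂ _).2 ⟨hn', h'⟩)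
  -- two cosets of `𝒞` containing the same point coincide
  have huniq : ∀ c ∈ 𝒞, ∀ c' ∈ 𝒞, ∀ n, n * (rep c)⁻¹ ∈ N₂ → n * (rep c')⁻¹ ∈ N₂ → c = c' := by
    intro c hc c' hc' n h1 h2
    ext x
    rw [hmem_c c hc, hmem_c c' hc']
    have key : ∀ t t' : G, n * t⁻¹ ∈ N₂ → n * t'⁻¹ ∈ N₂ → x * t⁻¹ ∈ N₂ → x * t'⁻¹ ∈ N₂ := by
      intro t t' ht ht' hx
      have : x * t'⁻¹ = (x * t⁻¹) * (n * t⁻¹)⁻¹ * (n * t'⁻¹) := by group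
      rw [this]
      exact N₂.mul_mem (N₂.mul_mem hx (N₂.inv_mem ht)) ht'
    exact ⟨key _ _ h1 h2, key _ _ h2 h1⟩
  -- invariance along a coset: `f (w rep c) = f (w n)` when `n rep⁻¹ ∈ N₂`
  have hcoset : ∀ c ∈ 𝒞, ∀ n ∈ N, n * (rep c)⁻¹ ∈ N₂ → f (w * rep c) = f (w * n) := by
    intro c hc n hn h2
    obtain ⟨huN, hu1⟩ := (hmemN₂ _).1 h2
    have := hfinv (rep c) (hrepN c hc) (n * (rep c)⁻¹) huN hu1
    rw [← this, mul_assoc w, hN _ (hrepN c hc) _ huN, inv_mul_cancel_right]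
  -- the profiles of `f` and `f'` agree on `N`
  have hprofile : ∀ n ∈ N, f' (w * n) = f (w * n) := by
    intro n hn
    show (∑ c ∈ 𝒞, a c * e₁ (w * n * (rep c)⁻¹)) = f (w * n)
    by_cases hex : ∃ c ∈ 𝒞, n * (rep c)⁻¹ ∈ N₂
    · obtain ⟨c₀, hc₀, hn₀⟩ := hex
      rw [Finset.sum_eq_single_of_mem c₀ hc₀]
      · rw [hprof_mem c₀ hc₀ n hn hn₀, ha]
        show f (w * rep c₀) * (χ pm * S)⁻¹ * (χ pm * S) = f (w * n)
        rw [mul_assoc, inv_mul_cancel₀ (mul_ne_zero (hχ pm hpm) hS), mul_one, hcoset c₀ hc₀ n hn hn₀]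
      · intro c hc hne
        rw [hprof_not c hc n hn (fun h => hne (huniq c hc c₀ hc₀ n h hn₀)), mul_zero]
    · rw [Finset.sum_eq_zero (fun c hc => by rw [hprof_not c hc n hn (fun h => hex ⟨c, hc, h⟩), mul_zero])]
      by_contra hne
      have hnS : n ∈ S₀ := hfsupp n hn (Ne.symm hne)
      obtain ⟨t, ht, hnt⟩ := hT n hnS
      refine hex ⟨{x | x * t⁻¹ ∈ N₂}, Finset.mem_image.2 ⟨t, ht, rfl⟩, ?_⟩
      exact (hmem_c _ (Finset.mem_image.2 ⟨t, ht, rfl⟩) n).1 hnt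
  -- `f = f'`
  have hlaw' : ∀ p ∈ P, ∀ h, f' (p * h) = χ p * f' h := by
    intro p hp h
    simp only [hf', Finset.mul_sum]
    refine Finset.sum_congr rfl fun c _ => ?_
    show a c * e (p * h * (rep c)⁻¹ * m) = χ p * (a c * e (h * (rep c)⁻¹ * m))
    rw [mul_assoc p h, mul_assoc p, he p hp, mul_left_comm]
  have hoff' : ∀ h, (¬ ∃ p ∈ P, ∃ n ∈ N, h = p * w * n) → f' h = 0 := by
    intro h hh
    simp only [hf']
    refine Finset.sum_eq_zero fun c hc => ?_
    show a c * e (h * (rep c)⁻¹ * m) = 0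
    rw [offCell_dilate heoff hpm hwm hconj _ (fun hex => ?_), mul_zero]
    obtain ⟨p, hp, n, hn, hpn⟩ := hex
    exact hh ⟨p, hp, n * rep c, N.mul_mem hn (hrepN c hc), by rw [← mul_assoc, ← hpn, mul_assoc, inv_mul_cancel, mul_one]⟩
  have hff' : f = f' := by
    funext h
    by_cases hh : ∃ p ∈ P, ∃ n ∈ N, h = p * w * n
    · obtain ⟨p, hp, n, hn, rfl⟩ := hh
      rw [mul_assoc, hf p hp, hlaw' p hp, hprofile n hn]
    · rw [hfoff h hh, hoff' h hh]
  rw [hff']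
  exact hf'U

omit [TopologicalSpace G] [IsTopologicalGroup G] in
/-- **(W2′) FROM A NON-ZERO PROFILE SUM TO THE INDICATOR PROFILE**: if `f₀ ∈ U` has the law `χ`, vanishes off `Ω`, is right-invariant under `N₀`, and its profile
vanishes on `N ∖ N₁` (`N₁ ≤ N`, `N₁ ∕ N₀` finite), then `F₁ := Σ_{q ∈ N₁∕N₀} R(q̃) f₀ ∈ U` has the law `χ`, vanishes off `Ω`, and has profile
`S·1_{N₁}` with `S = Σ_q f₀ (w q̃)`. [cite: BernsteinZelevinsky1976, §1.1, §2.2] -/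
theorem exists_indicator_profile_mem {P N N₀ N₁ : Subgroup G} (h1N : N₁ ≤ N) [Fintype (N₁ ⧸ N₀.subgroupOf N₁)]
    {χ : G → ℂ} {w : G} (U : Submodule ℂ (G → ℂ)) (hU : ∀ F ∈ U, ∀ g : G, (fun h => F (h * g)) ∈ U)
    {f₀ : G → ℂ} (hf₀U : f₀ ∈ U) (hf₀ : ∀ p ∈ P, ∀ h, f₀ (p * h) = χ p * f₀ h)
    (hf₀off : ∀ h, (¬ ∃ p ∈ P, ∃ n ∈ N, h = p * w * n) → f₀ h = 0)
    (hf₀inv : ∀ h, ∀ u ∈ N₀, f₀ (h * u) = f₀ h) (hf₀out : ∀ n ∈ N, n ∉ N₁ → f₀ (w * n) = 0) :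
    ∃ e ∈ U, (∀ p ∈ P, ∀ h, e (p * h) = χ p * e h) ∧ (∀ h, (¬ ∃ p ∈ P, ∃ n ∈ N, h = p * w * n) → e h = 0) ∧
      (∀ n ∈ N₁, e (w * n) = ∑ q : N₁ ⧸ N₀.subgroupOf N₁, f₀ (w * (q.out : G))) ∧ (∀ n ∈ N, n ∉ N₁ → e (w * n) = 0) := by
  classical
  refine ⟨fun h => ∑ q : N₁ ⧸ N₀.subgroupOf N₁, f₀ (h * (q.out : G)), ?_, ?_, ?_, ?_, ?_⟩
  · have : (fun h => ∑ q : N₁ ⧸ N₀.subgroupOf N₁, f₀ (h * (q.out : G))) =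
        ∑ q : N₁ ⧸ N₀.subgroupOf N₁, fun h => f₀ (h * (q.out : G)) := by
      funext h
      simp only [Finset.sum_apply]
    rw [this]
    exact Submodule.sum_mem U fun q _ => hU f₀ hf₀U _
  · intro p hp h
    show (∑ q : N₁ ⧸ N₀.subgroupOf N₁, f₀ (p * h * (q.out : G))) = χ p * ∑ q : N₁ ⧸ N₀.subgroupOf N₁, f₀ (h * (q.out : G))
    rw [Finset.mul_sum]
    exact Finset.sum_congr rfl fun q _ => by rw [mul_assoc, hf₀ p hp]
  · intro h hh
    exact Finset.sum_eq_zero fun q _ => offCell_translate hf₀off _ (h1N (q.out).2) h hh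
  · intro n hn
    exact profile_sum_translates_of_mem f₀ hf₀inv w n hn
  · intro n hn hn1
    exact profile_sum_translates_of_not_mem (N₀ := N₀) h1N f₀ w hf₀out n hn hn1

end Abstract




end Summit.HodgeConjecture.HodgeConjecture.Cruxes.HLiu418.K2LiuLocalSWBigCellLattice

end
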